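import Literature.StrongHypotheses.SmoothPoincare4
import Literature.Topology.FourManifolds.ThetaFour
import Literature.Topology.FourManifolds.HomotopySpheres
import Literature.Topology.FourManifolds.HomotopyS4CompactProofs
import Literature.Topology.FourManifolds.HomotopyS4OrientableProofs
import Literature.Topology.FourManifolds.ThetaFourKervaireMilnorFrontier
import Literature.Topology.FourManifolds.ThetaFourWall
import Mathlib.Geometry.Manifold.PoincareConjecture
import HarnessLib

/-!
# The h-cobordism conjecture at `S⁴` versus the smooth Poincaré conjecture in dimension 4

Topic `Literature/Topology/FourManifolds`; pure-proof file (theorems only: no definition, no named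
fact; net debt `0`) relating the registered strong hypothesis
`Literature.StrongHypotheses.SmoothPoincare4.HCobordantSphereFourStandard` ("every closed smooth
4-manifold smoothly h-cobordant to `S⁴` is diffeomorphic to `S⁴`", the `N = S⁴` instance of
Donaldson's "h-cobordism conjecture for smooth 4-manifolds", 1987, p. 142) to the smooth
4-dimensional Poincaré conjecture in Mathlib's wording,
`∀ (M : Type) [TopologicalSpace M] [T2Space M] [SecondCountableTopology M],
  ContinuousMap.HomotopyEquiv.NonemptyDiffeomorphSphere M 4`
— LITERALLY the body of the summit statement `SmoothPoincare4`
(`Summits/SmoothPoincare4/SmoothPoincare4/Statement.lean`, `:= Literature.SPC4.SmoothPoincareConjectureFour.{0}`),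
which a Literature file may not import (same device as `SPC4Wave0.lean`,
`ExistsExoticFourSphere.not_forall_nonemptyDiffeomorphSphere_four`). The summit-side bridge
`Summit.SmoothPoincare4.StrongHypotheses.HCobordantSphereFourStandardImpliesSmoothPoincare4`
(D-0034, `Summits/SmoothPoincare4/StrongHypotheses.lean`) is, definitionally, the first theorem below
with its conclusion folded back into `SmoothPoincare4`.

## The printed argument

Let `M` be a Hausdorff second-countable `C^∞` 4-manifold with `e : M ≃ₕ S⁴`.
(1) `M` is compact: `H₄(M; ℤ) ≅ H₄(S⁴; ℤ) ≠ 0` while a connected non-compact 4-manifold has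
`H₄ = 0` (Hatcher 2002, Prop. 3.29 with Cor. 2.11) — tree theorem
`compactSpace_of_homotopyEquiv_sphere_four_holds` (`HomotopyS4CompactProofs.lean`);
(2) `M` is orientable: `π₁(M) = π₁(S⁴) = 1` (Lee 2013, Thm. 15.43) — tree theorem
`isOrientable_of_homotopyEquiv_sphere_four_holds` (`HomotopyS4OrientableProofs.lean`);
(3) so `M` with a chosen orientation is a bundled `HomotopySphere 4`;
(4) **`Θ₄ = 0`**: every homotopy 4-sphere is smoothly h-cobordant to `S⁴` — Kervaire–Milnor 1963,
table of orders of `Θₙ` on p. 504, entry `n = 4 ↦ 1`, proved in Part I from Thm. 3.1 (p. 508), §4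
(`Θₙ/bPₙ₊₁ ↪ Πₙ/p(Sⁿ)`, table p. 512: `Π₄ = 0`), Thm. 5.1 (p. 512: `bP₅ = 0`) and Lemma 2.3
(p. 506: "A simply connected manifold `M` is h-cobordant to the sphere `Sⁿ` if and only if `M`
bounds a contractible manifold"); equivalently Wall 1964, Thm. 2, applied to `Σ ≃ S⁴` (both
intersection forms zero) — the tree's NAMED FACT `isHCobordant_sphere_of_homotopySphere_four`
(`ThetaFour.lean`);
(5) the hypothesis gives `M ≅ S⁴`.
Conversely (unconditionally) the two ends of an h-cobordism `W` are deformation retracts of `W`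
(Kervaire–Milnor 1963, §1, Definition), so a manifold h-cobordant to `S⁴` is homotopy equivalent to
`S⁴` and the Poincaré statement applies to it.

## Main statements (all proved; hypotheses are pre-existing tree facts only)

* `nonempty_diffeomorph_sphere_four_of_hCobordantSphereFourStandard` — steps (1)–(5) for one `M`,
  GIVEN `Θ₄ = 0` (`isHCobordant_sphere_of_homotopySphere_four`);
* `forall_nonemptyDiffeomorphSphere_four_of_hCobordantSphereFourStandard` — the bridge
  `Θ₄ = 0 → HCobordantSphereFourStandard → (body of SmoothPoincare4)`;
* `…_of_frontier`, `…_of_subsingleton_homotopyGroup` — the same over the two leaves on which the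
  tree's proof of `Θ₄ = 0` still rests (Thm. 3.1 for `n = 4` and `Π₄ = 0`, the latter also in
  Mathlib's `HomotopyGroup` vocabulary), via `isHCobordant_sphere_of_homotopySphere_four_of_frontier₄`
  (Lemma 2.3, Lemma 4.2 `⇒` and Thm. 5.1 at `k = 2` being tree theorems);
* `…_of_wallThmTwo` — the same over Wall's Thm. 2 (`isHCobordant_of_equivalent_intersectionForm`);
* `hCobordantSphereFourStandard_of_forall_nonemptyDiffeomorphSphere_four` — the CONVERSE,
  unconditional;
* `hCobordantSphereFourStandard_iff_forall_nonemptyDiffeomorphSphere_four` — the equivalence,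
  GIVEN `Θ₄ = 0` (row 1 of the registry `Literature/StrongHypotheses/SmoothPoincare4.lean`).

## References

* M. Kervaire, J. Milnor, *Groups of homotopy spheres I*, Ann. of Math. (2) 77 (1963) 504–537:
  §1 (Definition of h-cobordant, p. 504), table p. 504 (`Θ₄ = 0`), Lemma 2.3 (p. 506), Thm. 3.1
  (p. 508), §4 (table p. 512), Thm. 5.1 (p. 512). doi:10.2307/1970128 [KervaireMilnorAnnals1963]
* C. T. C. Wall, *On simply-connected 4-manifolds*, J. London Math. Soc. 39 (1964) 141–149, Thm. 2.
  [WallJLMS1964]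
* S. K. Donaldson, *Irrationality and the h-cobordism conjecture*, J. Differential Geom. 26 (1987)
  141–168, p. 142. [DonaldsonIrrationality1987]
* R. Kirby (ed.), *Problems in low-dimensional topology* (1997), Problem 4.89. [KirbyProblems1997]
* A. Hatcher, *Algebraic Topology*, CUP (2002), Prop. 3.29, Cor. 2.11. [HatcherAT2002]
* J. M. Lee, *Introduction to Smooth Manifolds*, 2nd ed., GTM 218 (2013), Thm. 15.43.
  [LeeSmoothManifolds2013]
-/

noncomputable section

open scoped Manifold ContDiff
open ContinuousMap

namespace Literature.Topology.FourManifolds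

open Literature.StrongHypotheses.SmoothPoincare4

/-! ### `HCobordantSphereFourStandard ⇒ SPC4`, given `Θ₄ = 0` -/

/-- **A homotopy 4-sphere is standard under the h-cobordism conjecture at `S⁴`, GIVEN `Θ₄ = 0`.**
For a Hausdorff second-countable `C^∞` 4-manifold `M : Type` and `e : M ≃ₕ S⁴`: `M` is compact
(`compactSpace_of_homotopyEquiv_sphere_four_holds`, Hatcher Prop. 3.29) and orientable
(`isOrientable_of_homotopyEquiv_sphere_four_holds`, Lee Thm. 15.43), so `(M, o, e)` is a bundled
`HomotopySphere 4`; `Θ₄ = 0` (Kervaire–Milnor 1963, table p. 504; the tree's named fact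
`isHCobordant_sphere_of_homotopySphere_four`, hypothesis `hΘ`) makes `M` h-cobordant to `S⁴`, and
the hypothesis `h : HCobordantSphereFourStandard` gives `M ≅ S⁴`.
[cite: KervaireMilnorAnnals1963, table p. 504 (Θ₄ = 0) via Thm. 5.1, §4 and Lemma 2.3 (p. 506)] -/
theorem nonempty_diffeomorph_sphere_four_of_hCobordantSphereFourStandard
    (h : HCobordantSphereFourStandard) (hΘ : isHCobordant_sphere_of_homotopySphere_four)
    (M : Type) [TopologicalSpace M] [T2Space M] [SecondCountableTopology M]
    [ChartedSpace (EuclideanSpace ℝ (Fin 4)) M] [IsManifold (𝓡 4) ∞ M]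
    (e : M ≃ₕ Metric.sphere (0 : EuclideanSpace ℝ (Fin 5)) 1) :
    Nonempty (M ≃ₘ⟮𝓡 4, 𝓡 4⟯ (Metric.sphere (0 : EuclideanSpace ℝ (Fin 5)) 1)) := by
  -- (1) compactness: `H₄(M; ℤ) ≅ H₄(S⁴; ℤ) ≠ 0` (Hatcher Prop. 3.29, Cor. 2.11)
  haveI : CompactSpace M := compactSpace_of_homotopyEquiv_sphere_four_holds M e
  -- (2) orientability: `π₁(M) = 1` (Lee Thm. 15.43)
  obtain ⟨o⟩ := isOrientable_of_homotopyEquiv_sphere_four_holds M e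
  -- (3)–(5): bundle, apply `Θ₄ = 0`, apply the hypothesis
  exact h M (hΘ { carrier := M, orientation := o, nonempty_homotopyEquiv := ⟨e⟩ })

/-- **h-cobordism conjecture at `S⁴` ⟹ SPC4, GIVEN `Θ₄ = 0`**: the strong-hypothesis bridge with
its conclusion spelled as the literal body of `SmoothPoincare4`
(`∀ M, ContinuousMap.HomotopyEquiv.NonemptyDiffeomorphSphere M 4` over Hausdorff second-countable
`M : Type`). Kervaire–Milnor 1963, `Θ₄ = 0` (table p. 504) is the hypothesis `hΘ`; the rest is
`nonempty_diffeomorph_sphere_four_of_hCobordantSphereFourStandard`.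
[cite: KervaireMilnorAnnals1963, table p. 504 (Θ₄ = 0) via Thm. 5.1, §4 and Lemma 2.3 (p. 506)] -/
theorem forall_nonemptyDiffeomorphSphere_four_of_hCobordantSphereFourStandard
    (hΘ : isHCobordant_sphere_of_homotopySphere_four) (h : HCobordantSphereFourStandard) :
    ∀ (M : Type) [TopologicalSpace M] [T2Space M] [SecondCountableTopology M],
      HomotopyEquiv.NonemptyDiffeomorphSphere M 4 :=
  fun M _ _ _ _ _ e => nonempty_diffeomorph_sphere_four_of_hCobordantSphereFourStandard h hΘ M e

/-- **The bridge over Kervaire–Milnor's frontier.** `HCobordantSphereFourStandard` implies the body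
of `SmoothPoincare4` GIVEN the two leaves on which the tree's proof of `Θ₄ = 0` still rests: Thm. 3.1
for `n = 4` (every homotopy 4-sphere is s-parallelizable, `h31`) and `Π₄ = 0`
(`piStable_four_trivial`) — Lemma 2.3 (`isHCobordant_sphere_of_boundsContractible_holds`), Lemma 4.2
`⇒` (`boundsParallelizable_of_collapseNullHomotopic_holds`) and Thm. 5.1 at `k = 2`
(`HomotopySphere.boundsContractible_of_nullCobordism_isStablyParallelizable_four_holds`) being tree
theorems (`isHCobordant_sphere_of_homotopySphere_four_of_frontier₄`).
[cite: KervaireMilnorAnnals1963, table p. 504 (Θ₄ = 0) via Lemma 2.3, Thm. 3.1 (n = 4), §4 (Lemma 4.2, table p. 512) and Thm. 5.1] -/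
theorem forall_nonemptyDiffeomorphSphere_four_of_hCobordantSphereFourStandard_of_frontier
    (h31 : ∀ S : HomotopySphere 4, IsStablyParallelizable (𝓡 4) S.carrier)
    (hPi : piStable_four_trivial) (h : HCobordantSphereFourStandard) :
    ∀ (M : Type) [TopologicalSpace M] [T2Space M] [SecondCountableTopology M],
      HomotopyEquiv.NonemptyDiffeomorphSphere M 4 :=
  forall_nonemptyDiffeomorphSphere_four_of_hCobordantSphereFourStandard
    (isHCobordant_sphere_of_homotopySphere_four_of_frontier₄ h31
      boundsParallelizable_of_collapseNullHomotopic_holds hPi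
      HomotopySphere.boundsContractible_of_nullCobordism_isStablyParallelizable_four_holds) h

/-- **The bridge over the frontier, `Π₄ = 0` in Mathlib's vocabulary**: as
`forall_nonemptyDiffeomorphSphere_four_of_hCobordantSphereFourStandard_of_frontier`, with the stable
`4`-stem hypothesis stated as `Subsingleton (π_(4+k) Sᵏ x)` for every `k > 5` and every base point
(`piStable_four_trivial_of_subsingleton_homotopyGroup`; Kervaire–Milnor's table p. 512).
[cite: KervaireMilnorAnnals1963, §4, p. 510 and table p. 512 (Π₄ = 0)] -/
theorem forall_nonemptyDiffeomorphSphere_four_of_hCobordantSphereFourStandard_of_subsingleton_homotopyGroup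
    (h31 : ∀ S : HomotopySphere 4, IsStablyParallelizable (𝓡 4) S.carrier)
    (hPi : ∀ k : ℕ, 5 < k → ∀ x : Metric.sphere (0 : EuclideanSpace ℝ (Fin (k + 1))) 1,
      Subsingleton (HomotopyGroup (Fin (4 + k)) (Metric.sphere (0 : EuclideanSpace ℝ (Fin (k + 1))) 1) x))
    (h : HCobordantSphereFourStandard) :
    ∀ (M : Type) [TopologicalSpace M] [T2Space M] [SecondCountableTopology M],
      HomotopyEquiv.NonemptyDiffeomorphSphere M 4 :=
  forall_nonemptyDiffeomorphSphere_four_of_hCobordantSphereFourStandard_of_frontier h31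
    (piStable_four_trivial_of_subsingleton_homotopyGroup hPi) h

/-- **The bridge over Wall's Thm. 2.** `HCobordantSphereFourStandard` implies the body of
`SmoothPoincare4` GIVEN Wall 1964, Thm. 2 ("Two simply-connected closed 4-manifolds with isomorphic
quadratic forms are h-cobordant"; tree fact `isHCobordant_of_equivalent_intersectionForm`): the forms
of a homotopy 4-sphere and of `S⁴` are both zero, whence `Θ₄ = 0`
(`isHCobordant_sphere_of_homotopySphere_four_of_wallThmTwo`).
[cite: WallJLMS1964, Thm. 2 (p. 141)] [cite: KervaireMilnorAnnals1963, table p. 504 (Θ₄ = 0)] -/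
theorem forall_nonemptyDiffeomorphSphere_four_of_hCobordantSphereFourStandard_of_wallThmTwo
    (hW : isHCobordant_of_equivalent_intersectionForm) (h : HCobordantSphereFourStandard) :
    ∀ (M : Type) [TopologicalSpace M] [T2Space M] [SecondCountableTopology M],
      HomotopyEquiv.NonemptyDiffeomorphSphere M 4 :=
  forall_nonemptyDiffeomorphSphere_four_of_hCobordantSphereFourStandard
    (isHCobordant_sphere_of_homotopySphere_four_of_wallThmTwo hW) h

/-! ### The converse (unconditional) and the equivalence -/

/-- **SPC4 ⟹ the h-cobordism conjecture at `S⁴`** (unconditional): if `M` is smoothly h-cobordant to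
`S⁴` by `W`, both inclusions `M ↪ W`, `S⁴ ↪ W` are homotopy equivalences (Kervaire–Milnor 1963, §1:
the ends of an h-cobordism are deformation retracts of it), so `M ≃ₕ W ≃ₕ S⁴` and the Poincaré
statement applies to `M`. [cite: KervaireMilnorAnnals1963, §1 (Definition, p. 504)] -/
theorem hCobordantSphereFourStandard_of_forall_nonemptyDiffeomorphSphere_four
    (h : ∀ (M : Type) [TopologicalSpace M] [T2Space M] [SecondCountableTopology M],
      HomotopyEquiv.NonemptyDiffeomorphSphere M 4) :
    HCobordantSphereFourStandard := by
  intro M _ _ _ _ _ _ hcob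
  obtain ⟨c, ⟨e₁, -⟩, ⟨e₂, -⟩⟩ := hcob
  exact h M inferInstance inferInstance (e₁.trans e₂.symm)

/-- **The h-cobordism conjecture at `S⁴` is EQUIVALENT to SPC4, GIVEN `Θ₄ = 0`** (row 1 of the
registry `Literature/StrongHypotheses/SmoothPoincare4.lean`): `⇒` is
`forall_nonemptyDiffeomorphSphere_four_of_hCobordantSphereFourStandard` (Kervaire–Milnor 1963,
`Θ₄ = 0`, table p. 504), `⇐` is unconditional
(`hCobordantSphereFourStandard_of_forall_nonemptyDiffeomorphSphere_four`).
[cite: KervaireMilnorAnnals1963, table p. 504 (Θ₄ = 0) and §1] -/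
theorem hCobordantSphereFourStandard_iff_forall_nonemptyDiffeomorphSphere_four
    (hΘ : isHCobordant_sphere_of_homotopySphere_four) :
    HCobordantSphereFourStandard ↔
      ∀ (M : Type) [TopologicalSpace M] [T2Space M] [SecondCountableTopology M],
        HomotopyEquiv.NonemptyDiffeomorphSphere M 4 :=
  ⟨forall_nonemptyDiffeomorphSphere_four_of_hCobordantSphereFourStandard hΘ,
    hCobordantSphereFourStandard_of_forall_nonemptyDiffeomorphSphere_four⟩

end Literature.Topology.FourManifolds

end
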